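import Summits.BirchSwinnertonDyer.BirchSwinnertonDyer.Theorems.ResidualThetaTransportAtTwoLambdaLowerBoundOWeierstrass
import Summits.BirchSwinnertonDyer.BirchSwinnertonDyer.Theorems.ResidualThetaTransportAtTwoResidualSignedLambdaLowerCMAtTwoNormLambdaSocket
import Literature.NumberTheory.EllipticCurves.PAdicPowerSeriesZeros
import Mathlib.RingTheory.RootsOfUnity.AlgebraicallyClosed
import Mathlib.NumberTheory.Padics.Complex
import HarnessLib

/-!
# Stub-ideation k2 g6 — typed sketch for `stub_cmLambdaLower` (crux `ResidualThetaCountLowerPureAtTwo`,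
# skeleton `Lines/bt26_lambda.lean` v6; by name = route item `ResidualSignedLambdaLowerCMAtTwo`, RSL_g)

Seat `planner-sidea-stub_cmLambdaLower-2-g6-0` (stub-ideation, technique: literature transfer with a typed
dictionary). THEOREMS ONLY, no `sorry`, no new `def` carrying content (two transparent abbreviations).
Nothing here proves BSD, the crux, or the stub; it is the kernel kit behind the idea card
`Ideas/stub_cmLambdaLower-k2.md` (g6): the **Mazur–Tate–Teitelbaum / Višik uniqueness principle in
`𝒪`-currency** ("a non-zero element of `𝒪_E⟦T⟧` has at most `λ` zeros in the open unit disc of `ℂ_p`, so two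
`Λ_𝒪`-valued functionals with the same values at infinitely many `ζ − 1` are equal"), which is the lemma the
critic's STUB-PLAN rev 7 asks for as **U7 `stub_vsUnique`** / S12 (value form ⇒ element form) / T11.

Dictionary (print ↦ tree ℤ_p twin ↦ here, over `𝒪_E = unitBall p E`, `E/ℚ_p` finite inside `ℚ̄_p`):
* Lang, *Cyclotomic Fields I–II*, Ch. 5 §2 Thm 2.2 (Weierstrass preparation) and Ch. 7 §? p.130 l.17
  ("uniqueness is obvious since a power series has only a finite number of zeros"); Washington GTM 83 Thm 7.3;
  Cassels, *Local Fields*, Ch. 4 Thm 4.1 (Strassmann: at most `N` zeros, `N` = the LAST index of maximal norm)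
  ↦ `Literature.NumberTheory.EllipticCurves.MemIwasawaRat.finite_setOf_hasSum_zero` /
    `MemIwasawaRat.eq_zero_of_forall_hasSum_zero` (coefficients in `ℤ_p`, qualitative)
  ↦ `ncard_zeroLocus_le_of_normLambda` / `eq_zero_of_infinite_zeroLocus` / `eq_of_tsum_eq_on_infinite` below
    (coefficients in `𝒪_E`, QUANTITATIVE: `#zeros ≤ d`, `d` = the crux's own `normλ` exponent = the FIRST index
    of maximal norm).

BSD is not proved by any of this.
-/

set_option linter.dupNamespace false
set_option autoImplicit false

noncomputable section

open scoped Classical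

open PowerSeries

namespace Summit.BirchSwinnertonDyer.BirchSwinnertonDyer.Cruxes.ResidualThetaCountLowerPureAtTwo.SideaK2G6

open Literature.NumberTheory.Automorphic Literature.NumberTheory.EllipticCurves
open Summit.BirchSwinnertonDyer.BirchSwinnertonDyer.Theorems.LambdaLowerBoundO

universe u

/-! ## §1 `𝒪_E → ℂ_p` and the zero locus -/

section UnitBall

variable (p : ℕ) [Fact p.Prime] (E : IntermediateField ℚ_[p] (PadicAlgCl p))

/-- The embedding `𝒪_E ⊆ ℚ̄_p → ℂ_p` through which values are taken (the route's convention,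
`…NormLambdaSocket` §B/§C). -/
abbrev toCp : PadicIntermediateField.unitBall p E →+* ℂ_[p] :=
  (algebraMap (PadicAlgCl p) ℂ_[p]).comp (PadicIntermediateField.unitBall p E).subtype

/-- `toCp` is norm preserving. [folklore] -/
theorem norm_toCp (x : PadicIntermediateField.unitBall p E) : ‖toCp p E x‖ = ‖(x : PadicAlgCl p)‖ :=
  PadicComplex.norm_extends (p := p) (x : PadicAlgCl p)

/-- Elements of the unit ball have norm `≤ 1`. [folklore] -/
theorem norm_coe_le_one (x : PadicIntermediateField.unitBall p E) : ‖(x : PadicAlgCl p)‖ ≤ 1 := by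
  have h := PadicIntermediateField.valued_le_one_of_mem_unitBall p E x.2
  rw [PadicAlgCl.valuation_def] at h
  exact_mod_cast h

/-- The images in `ℂ_p` of the coefficients of `A ∈ 𝒪_E⟦T⟧` are bounded by `1`. [folklore] -/
theorem norm_toCp_coeff_le_one (A : PowerSeries (PadicIntermediateField.unitBall p E)) (k : ℕ) :
    ‖toCp p E (coeff k A)‖ ≤ 1 := by
  rw [norm_toCp]
  exact norm_coe_le_one p E _

/-- The **zero locus** of `L ∈ 𝒪_E⟦T⟧` in the open unit disc of `ℂ_p`:
`{z : |z| < 1, Σ_k L_k z^k = 0}`. -/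
abbrev zeroLocus (L : PowerSeries (PadicIntermediateField.unitBall p E)) : Set ℂ_[p] :=
  {z | ‖z‖ < 1 ∧ HasSum (fun k ↦ toCp p E (coeff k L) * z ^ k) 0}

variable [FiniteDimensional ℚ_[p] E]

/-! ## §2 Lemma Z_𝒪 (quantitative): under the crux's `normλ` binders at `d`, at most `d` zeros -/

/-- **Lemma Z_𝒪, Weierstrass form.** If `L ∈ 𝒪_E⟦T⟧ ∖ 0` satisfies the crux's two `normλ` binders at `d`
(`‖L_k‖ ≤ ‖L_d‖` for all `k`, `<` for `k < d`), then there is a MONIC polynomial `f ∈ 𝒪_E[X]` of degree `d`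
(the distinguished factor of `L/L_d`) whose roots in `ℂ_p` contain every zero of `L` in the open unit disc:
`L = L_d · f · u`, `u ∈ 𝒪_E⟦T⟧ˣ`, and `u(z) ≠ 0`, `L_d ≠ 0` for `|z| < 1`.
[cite: Lang1990, Ch. 5 §2 Thm. 2.2] [cite: Washington1997, §7.1 Thm. 7.3] -/
theorem exists_monic_zeroLocus_subset_roots (L : PowerSeries (PadicIntermediateField.unitBall p E)) (d : ℕ)
    (hL : L ≠ 0)
    (hle : ∀ k, ‖((coeff k L : PadicIntermediateField.unitBall p E) : PadicAlgCl p)‖ ≤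
      ‖((coeff d L : PadicIntermediateField.unitBall p E) : PadicAlgCl p)‖)
    (hlt : ∀ k, k < d → ‖((coeff k L : PadicIntermediateField.unitBall p E) : PadicAlgCl p)‖ <
      ‖((coeff d L : PadicIntermediateField.unitBall p E) : PadicAlgCl p)‖) :
    ∃ f : Polynomial (PadicIntermediateField.unitBall p E), f.Monic ∧ f.natDegree = d ∧
      zeroLocus p E L ⊆ ↑((f.map (toCp p E)).roots.toFinset) := by
  haveI := isAdicComplete_maximalIdeal_unitBall p E
  obtain ⟨L₀, hfac, hc0, hd1, hlow⟩ := exists_eq_C_mul_of_normLambda p E L d hL hle hlt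
  set c := coeff d L with hc
  have hord := order_map_residue_eq L₀ d hd1 hlow
  have hne : L₀.map (IsLocalRing.residue _) ≠ 0 := by
    intro h0
    rw [h0, order_zero] at hord
    exact ENat.top_ne_coe d hord
  obtain ⟨f, h, H⟩ := L₀.exists_isWeierstrassFactorization hne
  have hdeg : f.natDegree = d := by rw [H.natDegree_eq_toNat_order_map, hord, ENat.toNat_coe]
  have hmonic : f.Monic := H.isDistinguishedAt.monic
  refine ⟨f, hmonic, hdeg, ?_⟩
  rintro z ⟨hz, hsum⟩
  set φ : PadicIntermediateField.unitBall p E →+* ℂ_[p] := toCp p E with hφdef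
  have hbd : ∀ (A : PowerSeries (PadicIntermediateField.unitBall p E)) (k : ℕ), ‖φ (coeff k A)‖ ≤ 1 :=
    norm_toCp_coeff_le_one p E
  obtain ⟨V, hUV⟩ := H.isUnit.exists_right_inv
  -- `L(z) = L_d · f(z) · h(z)`
  have hval : ∑' k, φ (coeff k L) * z ^ k =
      φ c * (f.eval₂ φ z * ∑' k, φ (coeff k h) * z ^ k) := by
    rw [hfac, tsum_map_coeff_mul_mul_pow φ (hbd _) (hbd _) hz, (hasSum_map_coeff_C_mul_pow φ c z).tsum_eq,
      H.eq_mul, tsum_map_coeff_mul_mul_pow φ (hbd _) (hbd _) hz, (hasSum_map_coeff_coe_mul_pow φ f z).tsum_eq]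
  -- `h(z) ≠ 0` (right inverse) and `L_d ≠ 0` in `ℂ_p`
  have hU : (∑' k, φ (coeff k h) * z ^ k) * ∑' k, φ (coeff k V) * z ^ k = 1 := by
    rw [← tsum_map_coeff_mul_mul_pow φ (hbd _) (hbd _) hz, hUV]
    exact (hasSum_map_coeff_one_mul_pow φ z).tsum_eq
  have hh0 : ∑' k, φ (coeff k h) * z ^ k ≠ 0 := left_ne_zero_of_mul_eq_one hU
  have hc0' : φ c ≠ 0 := by
    intro h0
    apply hc0
    have h1 : ‖φ c‖ = 0 := by rw [h0, norm_zero]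
    rw [hφdef, norm_toCp, norm_eq_zero] at h1
    exact Subtype.ext h1
  have hfz : f.eval₂ φ z = 0 := by
    have h0 : ∑' k, φ (coeff k L) * z ^ k = 0 := hsum.tsum_eq
    rw [hval] at h0
    rcases mul_eq_zero.1 h0 with h1 | h1
    · exact absurd h1 hc0'
    rcases mul_eq_zero.1 h1 with h2 | h2
    · exact h2
    · exact absurd h2 hh0
  have hfne : f.map φ ≠ 0 := (hmonic.map φ).ne_zero
  simp only [Finset.mem_coe, Multiset.mem_toFinset, Polynomial.mem_roots hfne, Polynomial.IsRoot.def,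
    Polynomial.eval_map]
  exact hfz

/-- **Lemma Z_𝒪 (finiteness).** Under the `normλ` binders the zero locus is finite.
[cite: Lang1990, Ch. 5 §2 Thm. 2.2] -/
theorem finite_zeroLocus_of_normLambda (L : PowerSeries (PadicIntermediateField.unitBall p E)) (d : ℕ)
    (hL : L ≠ 0)
    (hle : ∀ k, ‖((coeff k L : PadicIntermediateField.unitBall p E) : PadicAlgCl p)‖ ≤
      ‖((coeff d L : PadicIntermediateField.unitBall p E) : PadicAlgCl p)‖)
    (hlt : ∀ k, k < d → ‖((coeff k L : PadicIntermediateField.unitBall p E) : PadicAlgCl p)‖ <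
      ‖((coeff d L : PadicIntermediateField.unitBall p E) : PadicAlgCl p)‖) :
    (zeroLocus p E L).Finite := by
  obtain ⟨f, -, -, hsub⟩ := exists_monic_zeroLocus_subset_roots p E L d hL hle hlt
  exact (Finset.finite_toSet _).subset hsub

/-- **Lemma Z_𝒪 (quantitative: `#zeros ≤ λ = d`).** Under the crux's `normλ` binders at `d`, `L` has at most
`d` zeros in the open unit disc of `ℂ_p` (Strassmann's bound with the FIRST index of maximal norm, which is
sharper than Cassels' last-index `N` and is what Weierstrass preparation gives over a complete DVR).
[cite: Cassels1986, Ch. 4 Thm. 4.1] [cite: Washington1997, §7.1 Thm. 7.3] -/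
theorem ncard_zeroLocus_le_of_normLambda (L : PowerSeries (PadicIntermediateField.unitBall p E)) (d : ℕ)
    (hL : L ≠ 0)
    (hle : ∀ k, ‖((coeff k L : PadicIntermediateField.unitBall p E) : PadicAlgCl p)‖ ≤
      ‖((coeff d L : PadicIntermediateField.unitBall p E) : PadicAlgCl p)‖)
    (hlt : ∀ k, k < d → ‖((coeff k L : PadicIntermediateField.unitBall p E) : PadicAlgCl p)‖ <
      ‖((coeff d L : PadicIntermediateField.unitBall p E) : PadicAlgCl p)‖) :
    (zeroLocus p E L).ncard ≤ d := by
  obtain ⟨f, hmonic, hdeg, hsub⟩ := exists_monic_zeroLocus_subset_roots p E L d hL hle hlt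
  calc (zeroLocus p E L).ncard
      ≤ (↑((f.map (toCp p E)).roots.toFinset) : Set ℂ_[p]).ncard :=
        Set.ncard_le_ncard hsub (Finset.finite_toSet _)
    _ = ((f.map (toCp p E)).roots.toFinset).card := Set.ncard_coe_finset _
    _ ≤ Multiset.card (f.map (toCp p E)).roots := Multiset.toFinset_card_le _
    _ ≤ (f.map (toCp p E)).natDegree := Polynomial.card_roots' _
    _ = d := by rw [hmonic.natDegree_map, hdeg]

/-! ## §3 Every non-zero `L ∈ 𝒪_E⟦T⟧` has a `normλ` index (generic `p`; the `p = 2` newform-carrier instance is the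
landed `ResidualThetaLayer.stub_normLambdaWitnessAtTwo`) -/

/-- **`normλ` witness over `𝒪_E`.** A non-zero `L ∈ 𝒪_E⟦T⟧` has an index `d` with `‖L_k‖ ≤ ‖L_d‖` for all
`k` and `<` for `k < d`: `𝒪_E` is a DVR, the non-zero coefficient norms lie in `{|ϖ|ⁿ}` and a maximum is
attained; `d` is the first index attaining it. (Port of the landed `p = 2` proof to generic `p`.)
[cite: NeukirchANT1999, Ch. II (4.8)] -/
theorem exists_normLambdaIndex (L : PowerSeries (PadicIntermediateField.unitBall p E)) (hL : L ≠ 0) :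
    ∃ d : ℕ, (∀ k, ‖((coeff k L : PadicIntermediateField.unitBall p E) : PadicAlgCl p)‖ ≤
        ‖((coeff d L : PadicIntermediateField.unitBall p E) : PadicAlgCl p)‖) ∧
      (∀ k, k < d → ‖((coeff k L : PadicIntermediateField.unitBall p E) : PadicAlgCl p)‖ <
        ‖((coeff d L : PadicIntermediateField.unitBall p E) : PadicAlgCl p)‖) := by
  haveI : IsDiscreteValuationRing (PadicIntermediateField.unitBall p E) := isDiscreteValuationRing_unitBall p E
  obtain ⟨ϖ, hϖ⟩ := IsDiscreteValuationRing.exists_irreducible (PadicIntermediateField.unitBall p E)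
  set c : ℝ := ‖(ϖ : PadicAlgCl p)‖ with hc
  have hc1 : c < 1 := by
    have hle : Valued.v (ϖ : PadicAlgCl p) ≤ 1 := PadicIntermediateField.valued_le_one_of_mem_unitBall p E ϖ.2
    have hne : Valued.v (ϖ : PadicAlgCl p) ≠ 1 := fun h ↦
      hϖ.not_isUnit (PadicIntermediateField.isUnit_of_valued_eq_one p E h)
    have hlt : Valued.v (ϖ : PadicAlgCl p) < 1 := lt_of_le_of_ne hle hne
    rw [PadicAlgCl.valuation_def] at hlt
    exact_mod_cast hlt
  have hc0 : 0 < c := by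
    rw [hc, norm_pos_iff]
    intro h
    exact hϖ.ne_zero (Subtype.ext h)
  have hnormU : ∀ x : PadicIntermediateField.unitBall p E, x ≠ 0 → ∃ n : ℕ, ‖(x : PadicAlgCl p)‖ = c ^ n := by
    intro x hx
    obtain ⟨n, u, hxu⟩ := IsDiscreteValuationRing.eq_unit_mul_pow_irreducible hx hϖ
    refine ⟨n, ?_⟩
    have hu : ‖((u : PadicIntermediateField.unitBall p E) : PadicAlgCl p)‖ = 1 := by
      have := PadicIntermediateField.valued_eq_one_of_isUnit p E (Units.isUnit u)
      rw [PadicAlgCl.valuation_def] at this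
      rw [← coe_nnnorm, this, NNReal.coe_one]
    rw [hxu, Subring.coe_mul, Subring.coe_pow, norm_mul, norm_pow, hu, one_mul]
  -- the coefficient sequence, as an opaque function `a`
  obtain ⟨a, ha⟩ : ∃ a : ℕ → PadicAlgCl p,
      ∀ k, a k = ((coeff k L : PadicIntermediateField.unitBall p E) : PadicAlgCl p) := ⟨_, fun _ ↦ rfl⟩
  suffices H : ∃ d : ℕ, (∀ k, ‖a k‖ ≤ ‖a d‖) ∧ (∀ k, k < d → ‖a k‖ < ‖a d‖) by simpa only [ha] using H
  have hnorm : ∀ k, a k ≠ 0 → ∃ n : ℕ, ‖a k‖ = c ^ n := by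
    intro k hk
    obtain ⟨n, hn⟩ := hnormU (coeff k L) (fun h ↦ hk (by rw [ha k, h, ZeroMemClass.coe_zero]))
    exact ⟨n, by rw [ha k]; exact hn⟩
  have hex : ∃ k, a k ≠ 0 := by
    by_contra h
    push Not at h
    apply hL
    exact PowerSeries.ext fun k ↦ by
      rw [map_zero]
      exact Subtype.ext (by rw [← ha k, ZeroMemClass.coe_zero]; exact h k)
  have hP : ∃ n : ℕ, ∃ k, a k ≠ 0 ∧ ‖a k‖ = c ^ n := by
    obtain ⟨k, hk⟩ := hex
    obtain ⟨n, hn⟩ := hnorm k hk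
    exact ⟨n, k, hk, hn⟩
  set n₀ := Nat.find hP with hn₀
  have hn₀spec : ∃ k, a k ≠ 0 ∧ ‖a k‖ = c ^ n₀ := Nat.find_spec hP
  have hn₀min : ∀ k, a k ≠ 0 → c ^ n₀ ≥ ‖a k‖ := by
    intro k hk
    obtain ⟨n, hn⟩ := hnorm k hk
    have hle : n₀ ≤ n := Nat.find_min' hP ⟨k, hk, hn⟩
    rw [hn]
    exact pow_le_pow_of_le_one hc0.le hc1.le hle
  set d := Nat.find hn₀spec with hd
  obtain ⟨hd0, hdn⟩ : a d ≠ 0 ∧ ‖a d‖ = c ^ n₀ := Nat.find_spec hn₀spec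
  refine ⟨d, fun k ↦ ?_, fun k hk ↦ ?_⟩
  · rw [hdn]
    by_cases hk : a k = 0
    · rw [hk, norm_zero]; exact pow_nonneg hc0.le _
    · exact hn₀min k hk
  · rw [hdn]
    by_cases hk0 : a k = 0
    · rw [hk0, norm_zero]; exact pow_pos hc0 _
    · obtain ⟨n, hn⟩ := hnorm k hk0
      have hle : n₀ ≤ n := Nat.find_min' hP ⟨k, hk0, hn⟩
      have hne : n ≠ n₀ := by
        intro h
        exact Nat.find_min hn₀spec hk ⟨hk0, by rw [hn, h]⟩
      rw [hn]
      exact pow_lt_pow_right_of_lt_one₀ hc0 hc1 (lt_of_le_of_ne hle (Ne.symm hne))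

/-! ## §4 The uniqueness principle (U7 core): infinitely many zeros ⇒ `L = 0`; equal values on an infinite
set ⇒ equal elements ⇒ equal functionals -/

/-- **Uniqueness principle, element form.** An element of `𝒪_E⟦T⟧` with infinitely many zeros in the open unit
disc of `ℂ_p` is `0`. [cite: Lang1990, Ch. 5 §2 Thm. 2.2 and p. 130] -/
theorem eq_zero_of_infinite_zeroLocus (L : PowerSeries (PadicIntermediateField.unitBall p E))
    (hinf : (zeroLocus p E L).Infinite) : L = 0 := by
  by_contra hL
  obtain ⟨d, hle, hlt⟩ := exists_normLambdaIndex p E L hL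
  exact hinf (finite_zeroLocus_of_normLambda p E L d hL hle hlt)

/-- **Uniqueness principle, two elements.** If `F, G ∈ 𝒪_E⟦T⟧` take the same value `Σ F_k z^k = Σ G_k z^k` at
every point of an infinite subset `Z` of the open unit disc of `ℂ_p`, then `F = G`.
[cite: Lang1990, Ch. 5 §2 Thm. 2.2 and p. 130] -/
theorem eq_of_tsum_eq_on_infinite {F G : PowerSeries (PadicIntermediateField.unitBall p E)} (Z : Set ℂ_[p])
    (hZ : Z.Infinite) (hZ1 : ∀ z ∈ Z, ‖z‖ < 1)
    (h : ∀ z ∈ Z, ∑' k, toCp p E (coeff k F) * z ^ k = ∑' k, toCp p E (coeff k G) * z ^ k) : F = G := by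
  rw [← sub_eq_zero]
  apply eq_zero_of_infinite_zeroLocus p E
  -- `Z ⊆ zeroLocus (F - G)`
  have hsub : Z ⊆ zeroLocus p E (F - G) := by
    intro z hz
    have hz1 := hZ1 z hz
    have hF := (summable_map_coeff_mul_pow (toCp p E) (norm_toCp_coeff_le_one p E F) hz1).hasSum
    have hG := (summable_map_coeff_mul_pow (toCp p E) (norm_toCp_coeff_le_one p E G) hz1).hasSum
    have hFG := hF.sub hG
    rw [h z hz, sub_self] at hFG
    refine ⟨hz1, ?_⟩
    simpa only [map_sub, sub_mul] using hFG
  exact hZ.mono hsub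

/-- **Uniqueness principle, functional form (U7 core).** Two maps `𝒸, 𝒸' : H → 𝒪_E⟦T⟧` (e.g. two
`Λ_𝒪`-linear plus-Coleman functionals) whose values agree, for every `x : H`, at every point of one infinite
subset `Z` of the open unit disc, are equal. [cite: MazurTateTeitelbaum1986, §I.13] [cite: Lang1990, p. 130] -/
theorem funext_of_tsum_eq_on_infinite {H : Type u} (𝒸 𝒸' : H → PowerSeries (PadicIntermediateField.unitBall p E))
    (Z : Set ℂ_[p]) (hZ : Z.Infinite) (hZ1 : ∀ z ∈ Z, ‖z‖ < 1)
    (h : ∀ x, ∀ z ∈ Z, ∑' k, toCp p E (coeff k (𝒸 x)) * z ^ k = ∑' k, toCp p E (coeff k (𝒸' x)) * z ^ k) :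
    𝒸 = 𝒸' :=
  funext fun x ↦ eq_of_tsum_eq_on_infinite p E Z hZ hZ1 (h x)

end UnitBall

/-! ## §5 The test set: `ζ − 1` for `ζ` running through the primitive `p^n`-th roots of unity, `n` in any
infinite set of levels (e.g. the EVEN levels `≥ n₀` of the value spec VS) -/

section TestSet

variable (p : ℕ) [Fact p.Prime]

/-- For every level `n` there is a primitive `p^n`-th root of unity in `ℂ_p`. [folklore] -/
theorem exists_isPrimitiveRoot_Cp (n : ℕ) : ∃ ζ : ℂ_[p], IsPrimitiveRoot ζ (p ^ n) := by
  haveI : NeZero ((p : ℕ) : ℂ_[p]) := NeZero.charZero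
  exact HasEnoughRootsOfUnity.prim

/-- `|ζ − 1| < 1` for a `p`-power root of unity `ζ ∈ ℂ_p`. (tree: `norm_sub_one_lt_one_of_pow_prime_pow_eq_one`)
[folklore] -/
theorem norm_sub_one_lt_one_of_isPrimitiveRoot {n : ℕ} {ζ : ℂ_[p]} (hζ : IsPrimitiveRoot ζ (p ^ n)) :
    ‖ζ - 1‖ < 1 :=
  norm_sub_one_lt_one_of_pow_prime_pow_eq_one (p := p) hζ.pow_eq_one

/-- **The test set along an infinite set of levels is infinite**: `{ζ − 1 : ζ primitive of order p^n, n ∈ T}`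
is infinite whenever `T ⊆ ℕ` is (distinct levels give distinct orders). [folklore] -/
theorem infinite_testSet (T : Set ℕ) (hT : T.Infinite) :
    {z : ℂ_[p] | ∃ n ∈ T, IsPrimitiveRoot (z + 1) (p ^ n)}.Infinite := by
  have hp : 1 < p := (Fact.out : p.Prime).one_lt
  choose ζ hζ using exists_isPrimitiveRoot_Cp p
  have hinj : Function.Injective fun n : T ↦ ζ n - 1 := by
    intro m n hmn
    have hmn' : ζ m - 1 = ζ n - 1 := hmn
    have h1 : ζ m = ζ n := sub_left_injective hmn'
    have h2 : p ^ (m : ℕ) = p ^ (n : ℕ) := by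
      rw [(hζ m).eq_orderOf, (hζ n).eq_orderOf, h1]
    exact Subtype.ext (Nat.pow_right_injective hp h2)
  haveI : Infinite T := hT.to_subtype
  refine Set.infinite_of_injective_forall_mem hinj fun n ↦ ?_
  exact ⟨n, n.2, by simpa using hζ n⟩

/-- Every point of the test set lies in the open unit disc. [folklore] -/
theorem norm_lt_one_of_mem_testSet (T : Set ℕ) {z : ℂ_[p]}
    (hz : z ∈ {z : ℂ_[p] | ∃ n ∈ T, IsPrimitiveRoot (z + 1) (p ^ n)}) : ‖z‖ < 1 := by
  obtain ⟨n, -, hn⟩ := hz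
  have h := norm_sub_one_lt_one_of_isPrimitiveRoot p hn
  rwa [add_sub_cancel_right] at h

end TestSet

/-! ## §6 Crux currency: `𝒪 = padicCoeffIntegers S`, `Λ_𝒪 = IwasawaAlgebraO S`, the route's value convention
`Σ_k ι(L_k) (ζ−1)^k` of `…NormLambdaSocket` §C / H7 `eval₂_eq_mul_tsum_of_isCongrModOmegaO` -/

section CruxCurrency

variable (p : ℕ) [Fact p.Prime] (S : Set (PadicAlgCl p)) [FiniteDimensional ℚ_[p] (padicCoeffField S)]

/-- **(Plan 1 / U7 `stub_vsUnique` core, crux currency.)** Two elements of `Λ_𝒪 = IwasawaAlgebraO S` with the same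
`ℂ_p`-values at every point of an infinite subset of the open unit disc are equal. With `Z` = the VS test set
(`ζ − 1`, `ζ` primitive of even level `≥ n₀`, infinite by `infinite_testSet`) this is exactly what turns the value
spec VS into `𝒸 = 𝒸'` (apply to `𝒸 x`, `𝒸' x` for each `x`). [cite: MazurTateTeitelbaum1986, §I.13]
[cite: Lang1990, Ch. 5 §2 Thm. 2.2] -/
theorem iwasawaAlgebraO_eq_of_tsum_eq_on_infinite :
    ∀ (Z : Set ℂ_[p]), Z.Infinite → (∀ z ∈ Z, ‖z‖ < 1) → ∀ (F G : IwasawaAlgebraO S),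
      (∀ z ∈ Z, ∑' k, ((algebraMap (PadicAlgCl p) ℂ_[p]).comp (padicCoeffIntegers S).subtype) (PowerSeries.coeff k F) * z ^ k =
        ∑' k, ((algebraMap (PadicAlgCl p) ℂ_[p]).comp (padicCoeffIntegers S).subtype) (PowerSeries.coeff k G) * z ^ k) →
      F = G := by
  unfold IwasawaAlgebraO
  rw [padicCoeffIntegers_eq_unitBall S]
  intro Z hZ hZ1 F G h
  exact eq_of_tsum_eq_on_infinite p (padicCoeffField S) Z hZ hZ1 h

/-- **(Plan 1, functional form in crux currency.)** Two `Λ_𝒪`-linear functionals `𝒸, 𝒸' : H →ₗ Λ_𝒪` whose values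
agree at an infinite test set are equal — the kernel content of U7 `stub_vsUnique` once VS is read as "the value of
`𝒸 z` at `ζ − 1` is the prescribed plus-period sum" at all primitive `ζ` of even level `≥ n₀`.
[cite: MazurTateTeitelbaum1986, §I.13] [cite: Kobayashi2003, Thm. 6.2 (interpolation of the ± Coleman maps)] -/
theorem linearMap_eq_of_tsum_eq_on_infinite {H : Type u} [AddCommGroup H] [Module (IwasawaAlgebraO S) H]
    (𝒸 𝒸' : H →ₗ[IwasawaAlgebraO S] IwasawaAlgebraO S) (Z : Set ℂ_[p]) (hZ : Z.Infinite)
    (hZ1 : ∀ z ∈ Z, ‖z‖ < 1)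
    (h : ∀ x, ∀ z ∈ Z,
      ∑' k, ((algebraMap (PadicAlgCl p) ℂ_[p]).comp (padicCoeffIntegers S).subtype) (PowerSeries.coeff k (𝒸 x)) * z ^ k =
        ∑' k, ((algebraMap (PadicAlgCl p) ℂ_[p]).comp (padicCoeffIntegers S).subtype) (PowerSeries.coeff k (𝒸' x)) * z ^ k) :
    𝒸 = 𝒸' :=
  LinearMap.ext fun x ↦ iwasawaAlgebraO_eq_of_tsum_eq_on_infinite p S Z hZ hZ1 (𝒸 x) (𝒸' x) (h x)

/-- **(Plan 3, crux currency: at most `d` exceptional characters.)** Under EXACTLY the crux's binders on `Lm`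
(`Lm ≠ 0` from `IsPollackPairK`, `normλ` at `d`), `Lm` vanishes at at most `d` points of the open unit disc —
so, through H7 (`eval₂_eq_mul_tsum_of_isCongrModOmegaO`) and `ω⁻_n(ζ−1) ≠ 0` at even-level `ζ`, at most `d`
even-level wild characters `χ` have `θ_n(g)(χ) = 0`: an EFFECTIVE plus-side Rohrlich bound and the choice of a
non-vanishing witness level for the HOLD's clause (nz). [cite: Cassels1986, Ch. 4 Thm. 4.1]
[cite: Washington1997, §7.1 Thm. 7.3] [cite: RohrlichInventiones1984, Theorem p. 409] -/
theorem ncard_zeros_le_of_normLambda_iwasawaAlgebraO :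
    ∀ (Lm : IwasawaAlgebraO S) (d : ℕ), Lm ≠ 0 →
      (∀ k : ℕ, ‖coeff k (iwasawaOToPowerSeries S Lm)‖ ≤ ‖coeff d (iwasawaOToPowerSeries S Lm)‖) →
      (∀ k : ℕ, k < d → ‖coeff k (iwasawaOToPowerSeries S Lm)‖ < ‖coeff d (iwasawaOToPowerSeries S Lm)‖) →
      {z : ℂ_[p] | ‖z‖ < 1 ∧
        HasSum (fun k ↦ ((algebraMap (PadicAlgCl p) ℂ_[p]).comp (padicCoeffIntegers S).subtype)
          (PowerSeries.coeff k Lm) * z ^ k) 0}.ncard ≤ d := by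
  simp only [coeff_iwasawaOToPowerSeries]
  unfold IwasawaAlgebraO
  rw [padicCoeffIntegers_eq_unitBall S]
  intro Lm d hL hle hlt
  exact ncard_zeroLocus_le_of_normLambda p (padicCoeffField S) Lm d hL hle hlt

/-- **(Plan 2 interface: value form ⇒ element form for the HOLD's membership clause.)** If an element `x ∈ Λ_𝒪`
(read: `(C c) • 𝒸 z`) and a multiple `q * M` (read: `q · (D * Lm)`) have the same values on an infinite test set,
then `x ∈ (M)` — the value→element bridge S12 asks for, reduced to `iwasawaAlgebraO_eq_of_tsum_eq_on_infinite`.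
[cite: MazurTateTeitelbaum1986, §I.13] [cite: Kato2004, Thm. 16.6] -/
theorem mem_span_of_tsum_eq_on_infinite (Z : Set ℂ_[p]) (hZ : Z.Infinite) (hZ1 : ∀ z ∈ Z, ‖z‖ < 1)
    (x q M : IwasawaAlgebraO S)
    (h : ∀ z ∈ Z,
      ∑' k, ((algebraMap (PadicAlgCl p) ℂ_[p]).comp (padicCoeffIntegers S).subtype) (PowerSeries.coeff k x) * z ^ k =
        ∑' k, ((algebraMap (PadicAlgCl p) ℂ_[p]).comp (padicCoeffIntegers S).subtype) (PowerSeries.coeff k (q * M)) * z ^ k) :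
    x ∈ Ideal.span {M} := by
  have hx : x = q * M := iwasawaAlgebraO_eq_of_tsum_eq_on_infinite p S Z hZ hZ1 x (q * M) h
  rw [hx]
  exact Ideal.mul_mem_left _ q (Ideal.mem_span_singleton_self M)

/-- (transfer) Under the `normλ` binders the zero set of `Lm ∈ Λ_𝒪` in the open unit disc is finite.
[cite: Lang1990, Ch. 5 §2 Thm. 2.2] -/
theorem finite_zeros_of_normLambda_iwasawaAlgebraO :
    ∀ (Lm : IwasawaAlgebraO S) (d : ℕ), Lm ≠ 0 →
      (∀ k : ℕ, ‖coeff k (iwasawaOToPowerSeries S Lm)‖ ≤ ‖coeff d (iwasawaOToPowerSeries S Lm)‖) →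
      (∀ k : ℕ, k < d → ‖coeff k (iwasawaOToPowerSeries S Lm)‖ < ‖coeff d (iwasawaOToPowerSeries S Lm)‖) →
      {z : ℂ_[p] | ‖z‖ < 1 ∧
        HasSum (fun k ↦ ((algebraMap (PadicAlgCl p) ℂ_[p]).comp (padicCoeffIntegers S).subtype)
          (PowerSeries.coeff k Lm) * z ^ k) 0}.Finite := by
  simp only [coeff_iwasawaOToPowerSeries]
  unfold IwasawaAlgebraO
  rw [padicCoeffIntegers_eq_unitBall S]
  intro Lm d hL hle hlt
  exact finite_zeroLocus_of_normLambda p (padicCoeffField S) Lm d hL hle hlt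

omit [FiniteDimensional ℚ_[p] (padicCoeffField S)] in
/-- The images in `ℂ_p` of the coefficients of `L ∈ Λ_𝒪` are bounded by `1`. [folklore] -/
theorem norm_map_coeff_le_one (L : IwasawaAlgebraO S) (k : ℕ) :
    ‖((algebraMap (PadicAlgCl p) ℂ_[p]).comp (padicCoeffIntegers S).subtype) (PowerSeries.coeff k L)‖ ≤ 1 := by
  have h : ‖((algebraMap (PadicAlgCl p) ℂ_[p]).comp (padicCoeffIntegers S).subtype) (PowerSeries.coeff k L)‖ =
      ‖((PowerSeries.coeff k L : padicCoeffIntegers S) : PadicAlgCl p)‖ :=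
    PadicComplex.norm_extends (p := p) _
  rw [h]
  exact ((mem_padicCoeffIntegers_iff S _).1 (PowerSeries.coeff k L).2).2

end CruxCurrency

/-! ## §7 (Plan 3) Even levels: `θ_n(g)^ι(ζ − 1) = 0 ↔ L⁻(ζ − 1) = 0` at a primitive `ζ` of even level `n`, hence
at most `d` such `ζ` over ALL even levels — an effective plus-side Rohrlich bound inside the crux's own hypotheses -/

section EvenLevel

open Polynomial Literature.NumberTheory.EllipticCurves.ModularForms
open Summit.BirchSwinnertonDyer.BirchSwinnertonDyer.Theorems.NormLambdaSocket

variable {p : ℕ} [Fact p.Prime] {N : ℕ} {g : CuspForm (CongruenceSubgroup.Gamma0 N) 2}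
  {ι : coeffField g →+* PadicAlgCl p} {Ω : ℂ} {Lp Lm : IwasawaAlgebraO (Set.range ι)}

/-- Pollack's signed half-logarithm `(−1)^{⌊n/2⌋+1} ω⁻_n` does not vanish at `ζ − 1` for `ζ` primitive of
EVEN level `n` (tree: `eval₂_cyclotomicOmegaMinus_ne_zero`, Pollack 2003 Lemma 4.7). [cite: Pollack2003, Lemma 4.7] -/
theorem eval₂_signedOmegaMinus_ne_zero {n : ℕ} (hn : Even n) {ζ : ℂ_[p]} (hζ : IsPrimitiveRoot ζ (p ^ n)) :
    (((-1) ^ (n / 2 + 1) * cyclotomicOmegaMinus p n).map (Int.castRingHom (PadicAlgCl p))).eval₂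
        (algebraMap (PadicAlgCl p) ℂ_[p]) (ζ - 1) ≠ 0 := by
  rw [Polynomial.eval₂_map, Polynomial.eval₂_mul, Polynomial.eval₂_pow, Polynomial.eval₂_neg,
    Polynomial.eval₂_one]
  refine mul_ne_zero (pow_ne_zero _ (neg_ne_zero.2 one_ne_zero)) ?_
  have hφ : (algebraMap (PadicAlgCl p) ℂ_[p]).comp (Int.castRingHom (PadicAlgCl p)) = algebraMap ℤ ℂ_[p] :=
    RingHom.ext_int _ _
  rw [hφ]
  exact eval₂_cyclotomicOmegaMinus_ne_zero hn hζ

/-- **One-point lemma (Plan 3).** For a Pollack pair `(L⁺, L⁻)` of `g` along `ι` and `ζ ∈ ℂ_p` primitive of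
even level `n`: `θ_n(g)^ι(ζ − 1) = 0 ↔ L⁻(ζ − 1) = 0` (H7 `eval₂_eq_mul_tsum_of_isCongrModOmegaO` and the
non-vanishing of the signed half-log). [cite: Pollack2003, Prop. 6.18 and Lemma 4.7] -/
theorem mazurTateElementK_eval₂_eq_zero_iff (hP : IsPollackPairK g ι Ω Lp Lm) {n : ℕ} (hn : Even n)
    {ζ : ℂ_[p]} (hζ : IsPrimitiveRoot ζ (p ^ n)) :
    ((mazurTateElementK g Ω p n).map ι).eval₂ (algebraMap (PadicAlgCl p) ℂ_[p]) (ζ - 1) = 0 ↔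
      ∑' k, ((algebraMap (PadicAlgCl p) ℂ_[p]).comp (padicCoeffIntegers (Set.range ι)).subtype)
        (PowerSeries.coeff k Lm) * (ζ - 1) ^ k = 0 := by
  rw [eval₂_eq_mul_tsum_of_isCongrModOmegaO (Set.range ι) (hP.2.2.2 n hn) hζ.pow_eq_one]
  exact ⟨fun h ↦ (mul_eq_zero.1 h).resolve_left (eval₂_signedOmegaMinus_ne_zero hn hζ),
    fun h ↦ by rw [h, mul_zero]⟩

/-- **Effective plus-side Rohrlich bound inside the crux (Plan 3).** If `(L⁺, L⁻)` is a Pollack pair for `g`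
along `ι` and `L⁻` satisfies the crux's `normλ` binders at `d`, then AT MOST `d` primitive `p`-power roots of
unity `ζ` of even level satisfy `θ_n(g)^ι(ζ − 1) = 0` — all even levels together. (Rohrlich's theorem gives
"finitely many"; the crux's own exponent `d = λ(L⁻)` is the explicit bound, and every further even-level
character is a non-vanishing witness for the HOLD's clause (nz).) [cite: RohrlichInventiones1984, Theorem p. 409]
[cite: Pollack2003, Cor. 5.11 and Prop. 6.18] [cite: Washington1997, §7.1 Thm. 7.3] -/
theorem ncard_evenLevel_zeros_le [FiniteDimensional ℚ_[p] (padicCoeffField (Set.range ι))]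
    (hP : IsPollackPairK g ι Ω Lp Lm) {d : ℕ}
    (hle : ∀ k : ℕ, ‖coeff k (iwasawaOToPowerSeries (Set.range ι) Lm)‖ ≤
      ‖coeff d (iwasawaOToPowerSeries (Set.range ι) Lm)‖)
    (hlt : ∀ k : ℕ, k < d → ‖coeff k (iwasawaOToPowerSeries (Set.range ι) Lm)‖ <
      ‖coeff d (iwasawaOToPowerSeries (Set.range ι) Lm)‖) :
    {ζ : ℂ_[p] | ∃ n : ℕ, Even n ∧ IsPrimitiveRoot ζ (p ^ n) ∧
      ((mazurTateElementK g Ω p n).map ι).eval₂ (algebraMap (PadicAlgCl p) ℂ_[p]) (ζ - 1) = 0}.ncard ≤ d := by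
  have hLm : Lm ≠ 0 := hP.2.1
  have hfin := finite_zeros_of_normLambda_iwasawaAlgebraO p (Set.range ι) Lm d hLm hle hlt
  have hd := ncard_zeros_le_of_normLambda_iwasawaAlgebraO p (Set.range ι) Lm d hLm hle hlt
  refine le_trans (Set.ncard_le_ncard_of_injOn (fun ζ : ℂ_[p] ↦ ζ - 1) ?_ (sub_left_injective.injOn) hfin) hd
  rintro ζ ⟨n, hn, hζ, h0⟩
  have hz1 : ‖ζ - 1‖ < 1 := norm_sub_one_lt_one_of_isPrimitiveRoot p hζ
  refine ⟨hz1, ?_⟩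
  have hval := (mazurTateElementK_eval₂_eq_zero_iff hP hn hζ).1 h0
  have hs := (summable_map_coeff_mul_pow
    ((algebraMap (PadicAlgCl p) ℂ_[p]).comp (padicCoeffIntegers (Set.range ι)).subtype)
    (norm_map_coeff_le_one p (Set.range ι) Lm) hz1).hasSum
  rwa [hval] at hs

end EvenLevel

end Summit.BirchSwinnertonDyer.BirchSwinnertonDyer.Cruxes.ResidualThetaCountLowerPureAtTwo.SideaK2G6

end
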